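import Summits.Ventures.LatticeQCDFlow.Scaling.ConveyorPoincare
import Summits.Ventures.LatticeQCDFlow.Scaling.ReplicaExchangeBareErgodic
import Summits.Ventures.LatticeQCDFlow.Scaling.ReplicaExchangeBareModeBlocks
import Summits.Ventures.LatticeQCDFlow.Scaling.SimulatedTemperingModeGap

/-!
HONEST FRAMING: exact (Metropolis-corrected) sampling algorithms for lattice gauge theory; figures
of merit are autocorrelation/cost numbers at stated couplings and volumes; no continuum-physics
claim.

# ReplicaExchangeModeGap — REPLICA EXCHANGE BEATS METASTABILITY WHEN THE HOT REPLICA CROSSES SECTORS AND THE SECTOR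
# WEIGHTS PERSIST: ON A FINITE CONFIGURATION SPACE THE TAGLESS REPLICA-EXCHANGE SAMPLER HAS
# `Gap ≥ min{C/3, C(1−t)γ_A/((K+1)(3 + C))}` WITH `C = (p q^K/(6(K+1)))·min{tδ₂/K², (1−t)γ₀/(K+1)}` — within-MODE gaps
# `γ_A`, the HOT replica's gap BETWEEN modes `γ₀`, assignment-restricted swap overlaps `δ₂`, two-sided persistence
# `p`, `q`, AND NOTHING ABOUT THE COLD REPLICAS' BARRIER CROSSING; at `t = ½`:
# `Gap ≥ p q^K γ_A·min{δ₂/K², γ₀/(K+1)}/(96(K+1)²)`, `τ_int(g) ≤ 96(K+1)²/(p q^K γ_A·min{δ₂/K², γ₀/(K+1)}) − ½`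
# FOR EVERY OBSERVABLE (lean-2 GEN-18, ours)

Venture-side (OURS).  Cell `lqcd-flow` (pub-lqcd), unit `pub-lqcd-lean-2-g18`, 2026-08-25.  Assembles chapter R —
the replica-exchange (parallel tempering / PTBC) analogue of chapter Y (`Scaling/SimulatedTemperingModeGap`):
`Scaling/ReplicaExchangeBareModeBlocks` (the mode-assignment block structure of `P = ptBareSampler t μ M`),
`Scaling/ConveyorPoincare` (the projection chain's Poincaré constant: labels ride the swap ladder to the hot replica,
which relabels them) and the Literature's Jerrum–Son–Tetali–Vigoda Theorem 1 (PROVED in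
`MarkovChainDecomposition`).  Compare the torpid converses `Scaling/ReplicaExchangeModeTorpid` / `…SectorFlow`
(GEN-17): without a replica that crosses sectors the gap is at most the ladder-averaged sector exit flow.  Here the
cold replicas may be ARBITRARILY metastable: only their WITHIN-sector relaxation `γ_A` enters, together with the
hot replica's mode-projection gap `γ₀`, the assignment-restricted swap overlaps `δ₂`
(`δ₂·min{π̄(m), π̄(m∘σ_l)} ≤ Σ_{mode∘x = m} min{π̃(x), π̃(x∘σ_l)}`), the persistence `p` (`p·ν_k(j) ≤ ν_i(j)`, `i ≤ k`:
heating keeps the fraction `p` of a sector's weight) and the one-level cooling ratio `q` (`q·ν_l(j) ≤ ν_{l+1}(j)`).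

## What is proved (finite-chain vocabulary of `Literature.Probability.MarkovChains`)

* §1 `escapeProb_le_one'` (irreducibility of the sampler: `Scaling/ReplicaExchangeBareErgodic.ptBareSampler_isIrreducible`).
* §2 **`ptBareMode_projection_poincare`** — the conveyor for `(π̄, P̄)`: `C·Var_π̄ ≤ 𝓔_π̄(P̄)` for every `C ≥ 0` with
  `C·6K²(K+1) ≤ p q^K tδ₂` and `C·6(K+1)² ≤ p q^K γ₀(1−t)`.
* §3 **`ptBareMode_spectralGap_ge`** — JSTV: `Gap(P) ≥ min{C/3, C·λ_A/(3 + C)}`, `λ_A = (1−t)γ_A/(K+1)`.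
* §4 `t = ½`, `p, q, δ₂, γ_A ≤ 1`, `K ≥ 1`: **`ptBareModeHalf_spectralGap_ge`** —
  `Gap ≥ p q^K γ_A·min{δ₂/K², γ₀/(K+1)}/(96(K+1)²)`; **`ptBareModeHalf_asympVar_le`** / **`ptBareModeHalf_tauInt_le`** —
  for EVERY observable `g` of the replica configurations,
  `τ_int(g) ≤ 96(K+1)²/(p q^K γ_A·min{δ₂/K², γ₀/(K+1)}) − ½` (one step = one swap attempt or ONE replica update; per
  sweep of `K+1` updates divide by `K+1`).

Reading (no numerics implied): replica exchange in the boundary condition / coupling removes a free-energy barrier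
between topological sectors exactly when (i) ONE replica (the "hot" end: open boundary, small β) crosses sectors
(`γ₀`), (ii) every replica equilibrates inside each sector (`γ_A`), (iii) adjacent replicas accept swaps sector by
sector (`δ₂`), (iv) sector weights persist along the ladder both ways (`p`, `q^K`); the price relative to simulated
tempering (chapter Y: `pγ_A·min{δ/K, γ₀}/(25(K+1))` per system update) is one conveyor length `K` and the cooling
factor `q^K`.  NOT CLAIMED: sharp constants; the one-sided-persistence form (`q^K ↦ p^{#sectors}` under monotone
sector weights, Woodard–Schmidler–Huber 2009); the pair-overlap reduction of `δ₂`; the tagged sampler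
(`Scaling/ReplicaExchangeFiniteSampler`, whose configuration observables have the same autocovariances); general
configuration spaces; anything measured.  Literature grade (cell rule): KNOWN MECHANISM (Woodard–Schmidler–Huber,
Ann. Appl. Probab. 19 (2009) 617–640; Madras–Zheng 2003; Bhatnagar–Randall 2016), NEW TYPING (explicit constants for the
exact finite sampler with arbitrary exact replica updates); nothing cited as a fact; no new bib keys.
-/

noncomputable section

open Finset Function
open Literature.Probability.MarkovChains
open Literature.Probability.MarkovChains.Decomposition

namespace Summit.Ventures.LatticeQCDFlow.Scaling

section ModeGap

variable {S J : Type*} [Fintype S] [DecidableEq S] [Fintype J] [DecidableEq J] {K : ℕ}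
  {μ : Fin (K + 1) → S → ℝ} (hμ : ∀ k x, 0 < μ k x) (hμ1 : ∀ k, ∑ x, μ k x = 1)
  {M : Fin (K + 1) → S → S → ℝ} {mode : S → J} (hmode : Function.Surjective mode) {t : ℝ}

/-! ## §1 Escape -/

omit [DecidableEq S] [Fintype J] in
/-- Escape probabilities never exceed `1`. [ours] -/
theorem escapeProb_le_one' {X I : Type*} [Fintype X] [DecidableEq I] {P : Matrix X X ℝ} (hP : IsRowStochastic P)
    (blk : X → I) (x : X) : escapeProb P blk x ≤ 1 :=
  (escapeProb_le_escapeParameter P blk x).trans (escapeParameter_le_one hP blk)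

/-! ## §2 The projection chain: the conveyor -/

include hμ hμ1 hmode in
/-- **THE PROJECTION CHAIN'S POINCARÉ CONSTANT** (conveyor with `κ = tδ₂/K`, `ρ = γ₀`, `θ = (1−t)/(K+1)`): for every
`C ≥ 0` with `C·6K²(K+1) ≤ p q^K tδ₂` and `C·6(K+1)² ≤ p q^K γ₀(1−t)`, `C·Var_π̄(g) ≤ 𝓔_π̄(P̄; g)`. [ours] -/
theorem ptBareMode_projection_poincare (hK : 1 ≤ K) (hM : ∀ k, IsRowStochastic (M k)) (ht0 : 0 < t) (ht1 : t < 1)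
    {p q δ₂ γ₀ : ℝ} (hp : 0 < p) (hq0 : 0 < q) (hq1 : q ≤ 1) (hδ0 : 0 < δ₂) (hγ₀ : 0 < γ₀)
    (hpers : ∀ (i k : Fin (K + 1)) (j : J), i ≤ k → p * blockMass (μ k) mode j ≤ blockMass (μ i) mode j)
    (hq : ∀ (l : Fin K) (j : J), q * blockMass (μ l.castSucc) mode j ≤ blockMass (μ l.succ) mode j)
    (hδ : ∀ (m : Fin (K + 1) → J) (l : Fin K), m ∘ levelSwap l ≠ m →
      δ₂ * min (blockMass (tensorFun μ) (fun z : Fin (K + 1) → S => mode ∘ z) m)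
          (blockMass (tensorFun μ) (fun z : Fin (K + 1) → S => mode ∘ z) (m ∘ levelSwap l))
        ≤ ∑ x ∈ block (fun z : Fin (K + 1) → S => mode ∘ z) m, min (tensorFun μ x) (tensorFun μ (x ∘ levelSwap l)))
    (hgap0 : ∀ h : J → ℝ, γ₀ * lawVariance (blockMass (μ 0) mode) h
      ≤ dirichletForm (blockMass (μ 0) mode) (projectionChain (μ 0) (M 0) mode) h)
    {C : ℝ} (hC0 : 0 ≤ C) (hC1 : C * (6 * K ^ 2 * (K + 1)) ≤ p * q ^ K * (t * δ₂))
    (hC2 : C * (6 * (K + 1) ^ 2) ≤ p * q ^ K * γ₀ * (1 - t)) (g : (Fin (K + 1) → J) → ℝ) :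
    C * lawVariance (blockMass (tensorFun μ) (fun z : Fin (K + 1) → S => mode ∘ z)) g
      ≤ dirichletForm (blockMass (tensorFun μ) (fun z : Fin (K + 1) → S => mode ∘ z))
          (projectionChain (tensorFun μ) (ptBareSampler t μ M) (fun z : Fin (K + 1) → S => mode ∘ z)) g := by
  have hlaw : blockMass (tensorFun μ) (fun z : Fin (K + 1) → S => mode ∘ z)
      = tensorFun (fun k => blockMass (μ k) mode) := funext ptBareMode_blockMass
  have hKr : (1 : ℝ) ≤ K := by exact_mod_cast hK
  have hK0 : (0 : ℝ) < K := by linarith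
  have hP := ptBareSampler_isRowStochastic (M := M) hμ hM ht0.le ht1.le
  rw [hlaw]
  refine conveyor_poincare_of_cooling (ν := fun k => blockMass (μ k) mode)
    (Q := projectionChain (tensorFun μ) (ptBareSampler t μ M) (fun z : Fin (K + 1) → S => mode ∘ z))
    (fun k j => blockMass_nonneg (fun x => (hμ k x).le) mode j)
    (fun k => by rw [sum_blockMass, hμ1 k]) hp hq0 hq1 (by positivity : 0 < t * δ₂ / K) hγ₀
    (by apply div_pos (by linarith) (by positivity) : (0 : ℝ) < (1 - t) / (K + 1)) hpers hq
    (projectionChain_nonneg (fun x => (tensorFun_pos hμ x).le) hP.1 _) ?_ hgap0 ?_ g hC0 ?_ ?_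
  · -- transposition flows
    intro z l hzl
    have h := ptBareMode_proj_swap (M := M) hμ hmode hM ht0.le ht1.le hδ z l hzl
    rw [hlaw] at h
    exact h
  · -- hot relabels
    intro z v hv
    exact ptBareMode_proj_relabel (M := M) hμ hmode hM ht0.le ht1.le z v hv
  · -- `C·6K(K+1) ≤ p q^K (tδ₂/K)`
    rw [show p * q ^ K * (t * δ₂ / K) = p * q ^ K * (t * δ₂) / K by ring, le_div_iff₀ hK0]
    calc C * (6 * K * (K + 1)) * K = C * (6 * K ^ 2 * (K + 1)) := by ring
      _ ≤ p * q ^ K * (t * δ₂) := hC1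
  · -- `C·6(K+1) ≤ p q^K γ₀ (1−t)/(K+1)`
    rw [show p * q ^ K * γ₀ * ((1 - t) / (K + 1)) = p * q ^ K * γ₀ * (1 - t) / (K + 1) by ring,
      le_div_iff₀ (by positivity)]
    calc C * (6 * (K + 1)) * (K + 1) = C * (6 * (K + 1) ^ 2) := by ring
      _ ≤ p * q ^ K * γ₀ * (1 - t) := hC2

/-! ## §3 The spectral gap -/

include hμ hμ1 hmode in
/-- **THE SPECTRAL GAP OF THE REPLICA-EXCHANGE SAMPLER FROM WITHIN-MODE GAPS, THE HOT REPLICA'S GAP BETWEEN MODES,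
ASSIGNMENT-RESTRICTED SWAP OVERLAPS AND TWO-SIDED PERSISTENCE** (Jerrum–Son–Tetali–Vigoda Theorem 1 with mode
assignments as blocks): `Gap(ptBareSampler t μ M) ≥ min{C/3, C·λ_A/(3 + C)}`, `λ_A = (1−t)γ_A/(K+1)`, for every `C > 0`
with `C·6K²(K+1) ≤ p q^K tδ₂`, `C·6(K+1)² ≤ p q^K γ₀(1−t)` — NO hypothesis on the cold replicas' global mixing.
[ours] -/
theorem ptBareMode_spectralGap_ge [Nontrivial S] (hK : 1 ≤ K) (hM : ∀ k, IsRowStochastic (M k))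
    (hMrev : ∀ k, DetailedBalance (μ k) (M k)) (ht0 : 0 < t) (ht1 : t < 1)
    {p q δ₂ γ₀ γA : ℝ} (hp : 0 < p) (hq0 : 0 < q) (hq1 : q ≤ 1) (hδ0 : 0 < δ₂) (hγ₀ : 0 < γ₀) (hγA : 0 < γA)
    (hpers : ∀ (i k : Fin (K + 1)) (j : J), i ≤ k → p * blockMass (μ k) mode j ≤ blockMass (μ i) mode j)
    (hq : ∀ (l : Fin K) (j : J), q * blockMass (μ l.castSucc) mode j ≤ blockMass (μ l.succ) mode j)
    (hδ : ∀ (m : Fin (K + 1) → J) (l : Fin K), m ∘ levelSwap l ≠ m →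
      δ₂ * min (blockMass (tensorFun μ) (fun z : Fin (K + 1) → S => mode ∘ z) m)
          (blockMass (tensorFun μ) (fun z : Fin (K + 1) → S => mode ∘ z) (m ∘ levelSwap l))
        ≤ ∑ x ∈ block (fun z : Fin (K + 1) → S => mode ∘ z) m, min (tensorFun μ x) (tensorFun μ (x ∘ levelSwap l)))
    (hgap0 : ∀ h : J → ℝ, γ₀ * lawVariance (blockMass (μ 0) mode) h
      ≤ dirichletForm (blockMass (μ 0) mode) (projectionChain (μ 0) (M 0) mode) h)
    (hgapA : ∀ k j, ∀ h : S → ℝ, γA * lawVariance (blockLaw (μ k) mode j) h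
      ≤ dirichletForm (blockLaw (μ k) mode j) (restrictionChain (M k) mode) h)
    {C : ℝ} (hC0 : 0 < C) (hC1 : C * (6 * K ^ 2 * (K + 1)) ≤ p * q ^ K * (t * δ₂))
    (hC2 : C * (6 * (K + 1) ^ 2) ≤ p * q ^ K * γ₀ * (1 - t)) :
    min (C / 3) (C * ((1 - t) * γA / (K + 1)) / (3 * 1 + C))
      ≤ spectralGap (tensorFun μ) (ptBareSampler t μ M) := by
  exact JerrumEtAl2004_thm_1_spectralGap (tensorFun_pos hμ) (sum_tensorFun_eq_one μ hμ1)
    (ptBareSampler_isRowStochastic hμ hM ht0.le ht1.le) (ptBareSampler_detailedBalance hμ hMrev)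
    (modes_surjective hmode) hC0 (by apply div_pos (mul_pos (by linarith) hγA) (by positivity)) zero_le_one
    (ptBareMode_projection_poincare hμ hμ1 hmode hK hM ht0 ht1 hp hq0 hq1 hδ0 hγ₀ hpers hq hδ hgap0 hC0.le hC1 hC2)
    (fun m f => ptBareMode_restriction_poincare hμ hmode hM ht0.le ht1.le hgapA m f)
    (fun x => escapeProb_le_one' (ptBareSampler_isRowStochastic hμ hM ht0.le ht1.le) _ x)

/-! ## §4 The half-half scan in closed form, and the ceiling for every observable -/

include hμ hμ1 hmode in
/-- **`t = ½`: `Gap ≥ p q^K γ_A·min{δ₂/K², γ₀/(K+1)}/(96(K+1)²)`** (`p, q, δ₂, γ_A ≤ 1`, `K ≥ 1`). [ours] -/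
theorem ptBareModeHalf_spectralGap_ge [Nontrivial S] (hK : 1 ≤ K) (hM : ∀ k, IsRowStochastic (M k))
    (hMrev : ∀ k, DetailedBalance (μ k) (M k))
    {p q δ₂ γ₀ γA : ℝ} (hp : 0 < p) (hp1 : p ≤ 1) (hq0 : 0 < q) (hq1 : q ≤ 1) (hδ0 : 0 < δ₂) (hδ1 : δ₂ ≤ 1)
    (hγ₀ : 0 < γ₀) (hγA : 0 < γA) (hγA1 : γA ≤ 1)
    (hpers : ∀ (i k : Fin (K + 1)) (j : J), i ≤ k → p * blockMass (μ k) mode j ≤ blockMass (μ i) mode j)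
    (hq : ∀ (l : Fin K) (j : J), q * blockMass (μ l.castSucc) mode j ≤ blockMass (μ l.succ) mode j)
    (hδ : ∀ (m : Fin (K + 1) → J) (l : Fin K), m ∘ levelSwap l ≠ m →
      δ₂ * min (blockMass (tensorFun μ) (fun z : Fin (K + 1) → S => mode ∘ z) m)
          (blockMass (tensorFun μ) (fun z : Fin (K + 1) → S => mode ∘ z) (m ∘ levelSwap l))
        ≤ ∑ x ∈ block (fun z : Fin (K + 1) → S => mode ∘ z) m, min (tensorFun μ x) (tensorFun μ (x ∘ levelSwap l)))
    (hgap0 : ∀ h : J → ℝ, γ₀ * lawVariance (blockMass (μ 0) mode) h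
      ≤ dirichletForm (blockMass (μ 0) mode) (projectionChain (μ 0) (M 0) mode) h)
    (hgapA : ∀ k j, ∀ h : S → ℝ, γA * lawVariance (blockLaw (μ k) mode j) h
      ≤ dirichletForm (blockLaw (μ k) mode j) (restrictionChain (M k) mode) h) :
    p * q ^ K * γA * min (δ₂ / K ^ 2) (γ₀ / (K + 1)) / (96 * (K + 1) ^ 2)
      ≤ spectralGap (tensorFun μ) (ptBareSampler (1 / 2) μ M) := by
  have hKr : (1 : ℝ) ≤ K := by exact_mod_cast hK
  have hK0 : (0 : ℝ) < K := by linarith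
  have hK2 : (1 : ℝ) ≤ (K : ℝ) ^ 2 := by nlinarith
  have hqK : 0 < q ^ K := pow_pos hq0 K
  have hqK1 : q ^ K ≤ 1 := pow_le_one₀ hq0.le hq1
  set m₀ := min (δ₂ / K ^ 2) (γ₀ / (K + 1)) with hm₀
  have hm₀pos : 0 < m₀ := lt_min (div_pos hδ0 (by positivity)) (div_pos hγ₀ (by positivity))
  have hm₀le : m₀ ≤ 1 := by
    have h1 : m₀ ≤ δ₂ / K ^ 2 := min_le_left _ _
    have h2 : δ₂ / K ^ 2 ≤ 1 := by rw [div_le_one (by positivity)]; exact hδ1.trans hK2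
    exact h1.trans h2
  -- the admissible constant `C = p q^K m₀/(12(K+1))`
  set C := p * q ^ K * m₀ / (12 * (K + 1)) with hC
  have hCpos : 0 < C := by positivity
  have hC1 : C * (6 * K ^ 2 * (K + 1)) ≤ p * q ^ K * ((1 / 2 : ℝ) * δ₂) := by
    have h1 : m₀ * K ^ 2 ≤ δ₂ := by
      have := min_le_left (δ₂ / K ^ 2) (γ₀ / (K + 1))
      rw [← hm₀] at this
      calc m₀ * K ^ 2 ≤ δ₂ / K ^ 2 * K ^ 2 := mul_le_mul_of_nonneg_right this (by positivity)
        _ = δ₂ := div_mul_cancel₀ δ₂ (by positivity)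
    have e : C * (6 * K ^ 2 * (K + 1)) = p * q ^ K * (m₀ * K ^ 2) / 2 := by
      rw [hC]; field_simp; norm_num
    rw [e]
    have : p * q ^ K * (m₀ * K ^ 2) ≤ p * q ^ K * δ₂ := mul_le_mul_of_nonneg_left h1 (by positivity)
    linarith
  have hC2 : C * (6 * (K + 1) ^ 2) ≤ p * q ^ K * γ₀ * (1 - 1 / 2) := by
    have h1 : m₀ * (K + 1) ≤ γ₀ := by
      have := min_le_right (δ₂ / K ^ 2) (γ₀ / (K + 1))
      rw [← hm₀] at this
      calc m₀ * (K + 1) ≤ γ₀ / (K + 1) * (K + 1) := mul_le_mul_of_nonneg_right this (by positivity)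
        _ = γ₀ := div_mul_cancel₀ γ₀ (by positivity)
    have e : C * (6 * (K + 1) ^ 2) = p * q ^ K * (m₀ * (K + 1)) / 2 := by
      rw [hC]; field_simp; norm_num
    rw [e]
    have : p * q ^ K * (m₀ * (K + 1)) ≤ p * q ^ K * γ₀ := mul_le_mul_of_nonneg_left h1 (by positivity)
    linarith
  have key := ptBareMode_spectralGap_ge hμ hμ1 hmode hK hM hMrev (by norm_num : (0 : ℝ) < 1 / 2)
    (by norm_num : (1 / 2 : ℝ) < 1) hp hq0 hq1 hδ0 hγ₀ hγA hpers hq hδ hgap0 hgapA hCpos hC1 hC2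
  refine le_trans ?_ key
  -- `C ≤ 1/24`, so `min{C/3, C·(γ_A/(2(K+1)))/(3 + C)} ≥ Cγ_A/(8(K+1)) = p q^K γ_A m₀/(96(K+1)²)`
  have hCle : C ≤ 1 / 24 := by
    rw [hC, div_le_iff₀ (by positivity)]
    have h1 : p * q ^ K ≤ 1 := by nlinarith
    have h2 : p * q ^ K * m₀ ≤ 1 := by nlinarith
    have hK1 : (2 : ℝ) ≤ K + 1 := by linarith
    nlinarith
  have hval : p * q ^ K * γA * m₀ / (96 * (K + 1) ^ 2) = C * γA / (8 * (K + 1)) := by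
    rw [hC]
    field_simp
    norm_num
  rw [hval]
  refine le_min ?_ ?_
  · -- `CγA/(8(K+1)) ≤ C/3`
    rw [div_le_div_iff₀ (by positivity) (by norm_num)]
    have : γA * 3 ≤ 8 * (K + 1) := by nlinarith
    nlinarith [mul_le_mul_of_nonneg_left this hCpos.le]
  · -- `CγA/(8(K+1)) ≤ C((1/2)γA/(K+1))/(3 + C)`
    rw [show (1 : ℝ) - 1 / 2 = 1 / 2 by norm_num]
    rw [show C * (1 / 2 * γA / (K + 1)) / (3 * 1 + C) = C * γA / (2 * (K + 1) * (3 + C)) by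
      field_simp]
    rw [div_le_div_iff₀ (by positivity) (by positivity)]
    have h3 : 2 * (K + 1) * (3 + C) ≤ 8 * (K + 1) := by nlinarith
    exact mul_le_mul_of_nonneg_left h3 (by positivity)

include hμ hμ1 hmode in
/-- **The same with the hot replica's GLOBAL gap:** a Poincaré constant `γ₀` of `M_0` for `μ_0` passes to its mode
projection (`Scaling/SimulatedTemperingModeGap.projection_poincare_of_poincare`), so
`Gap ≥ p q^K γ_A·min{δ₂/K², γ₀/(K+1)}/(96(K+1)²)` also holds with `γ₀·Var_{μ_0} ≤ 𝓔_{μ_0}(M_0)`. [ours] -/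
theorem ptBareModeHalf_spectralGap_ge_of_hotGap [Nontrivial S] (hK : 1 ≤ K) (hM : ∀ k, IsRowStochastic (M k))
    (hMrev : ∀ k, DetailedBalance (μ k) (M k))
    {p q δ₂ γ₀ γA : ℝ} (hp : 0 < p) (hp1 : p ≤ 1) (hq0 : 0 < q) (hq1 : q ≤ 1) (hδ0 : 0 < δ₂) (hδ1 : δ₂ ≤ 1)
    (hγ₀ : 0 < γ₀) (hγA : 0 < γA) (hγA1 : γA ≤ 1)
    (hpers : ∀ (i k : Fin (K + 1)) (j : J), i ≤ k → p * blockMass (μ k) mode j ≤ blockMass (μ i) mode j)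
    (hq : ∀ (l : Fin K) (j : J), q * blockMass (μ l.castSucc) mode j ≤ blockMass (μ l.succ) mode j)
    (hδ : ∀ (m : Fin (K + 1) → J) (l : Fin K), m ∘ levelSwap l ≠ m →
      δ₂ * min (blockMass (tensorFun μ) (fun z : Fin (K + 1) → S => mode ∘ z) m)
          (blockMass (tensorFun μ) (fun z : Fin (K + 1) → S => mode ∘ z) (m ∘ levelSwap l))
        ≤ ∑ x ∈ block (fun z : Fin (K + 1) → S => mode ∘ z) m, min (tensorFun μ x) (tensorFun μ (x ∘ levelSwap l)))
    (hgap0 : ∀ h : S → ℝ, γ₀ * lawVariance (μ 0) h ≤ dirichletForm (μ 0) (M 0) h)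
    (hgapA : ∀ k j, ∀ h : S → ℝ, γA * lawVariance (blockLaw (μ k) mode j) h
      ≤ dirichletForm (blockLaw (μ k) mode j) (restrictionChain (M k) mode) h) :
    p * q ^ K * γA * min (δ₂ / K ^ 2) (γ₀ / (K + 1)) / (96 * (K + 1) ^ 2)
      ≤ spectralGap (tensorFun μ) (ptBareSampler (1 / 2) μ M) :=
  ptBareModeHalf_spectralGap_ge hμ hμ1 hmode hK hM hMrev hp hp1 hq0 hq1 hδ0 hδ1 hγ₀ hγA hγA1 hpers hq hδ
    (projection_poincare_of_poincare (fun j => (blockMass_pos (hμ 0) hmode j).ne') hgap0) hgapA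

include hμ hμ1 hmode in
/-- **THE CEILING FOR EVERY OBSERVABLE at `t = ½`:** with irreducible replica updates,
`asympVar(g) ≤ (2·96(K+1)²/(p q^K γ_A·min{δ₂/K², γ₀/(K+1)}) − 1)·Var_π̃(g)`. [ours] -/
theorem ptBareModeHalf_asympVar_le [Nontrivial S] (hK : 1 ≤ K) (hM : ∀ k, IsRowStochastic (M k))
    (hMrev : ∀ k, DetailedBalance (μ k) (M k)) (hMirr : ∀ k, IsIrreducible (M k))
    {p q δ₂ γ₀ γA : ℝ} (hp : 0 < p) (hp1 : p ≤ 1) (hq0 : 0 < q) (hq1 : q ≤ 1) (hδ0 : 0 < δ₂) (hδ1 : δ₂ ≤ 1)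
    (hγ₀ : 0 < γ₀) (hγA : 0 < γA) (hγA1 : γA ≤ 1)
    (hpers : ∀ (i k : Fin (K + 1)) (j : J), i ≤ k → p * blockMass (μ k) mode j ≤ blockMass (μ i) mode j)
    (hq : ∀ (l : Fin K) (j : J), q * blockMass (μ l.castSucc) mode j ≤ blockMass (μ l.succ) mode j)
    (hδ : ∀ (m : Fin (K + 1) → J) (l : Fin K), m ∘ levelSwap l ≠ m →
      δ₂ * min (blockMass (tensorFun μ) (fun z : Fin (K + 1) → S => mode ∘ z) m)
          (blockMass (tensorFun μ) (fun z : Fin (K + 1) → S => mode ∘ z) (m ∘ levelSwap l))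
        ≤ ∑ x ∈ block (fun z : Fin (K + 1) → S => mode ∘ z) m, min (tensorFun μ x) (tensorFun μ (x ∘ levelSwap l)))
    (hgap0 : ∀ h : J → ℝ, γ₀ * lawVariance (blockMass (μ 0) mode) h
      ≤ dirichletForm (blockMass (μ 0) mode) (projectionChain (μ 0) (M 0) mode) h)
    (hgapA : ∀ k j, ∀ h : S → ℝ, γA * lawVariance (blockLaw (μ k) mode j) h
      ≤ dirichletForm (blockLaw (μ k) mode j) (restrictionChain (M k) mode) h)
    (g : (Fin (K + 1) → S) → ℝ) :
    asympVar g (tensorFun μ) (ptBareSampler (1 / 2) μ M)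
      ≤ (2 / (p * q ^ K * γA * min (δ₂ / K ^ 2) (γ₀ / (K + 1)) / (96 * (K + 1) ^ 2)) - 1)
          * lawVariance (tensorFun μ) g := by
  have ht0 : (0 : ℝ) < 1 / 2 := by norm_num
  have ht1 : (1 / 2 : ℝ) < 1 := by norm_num
  have hP := ptBareSampler_isRowStochastic (M := M) hμ hM ht0.le ht1.le
  have hDB := ptBareSampler_detailedBalance (t := (1 / 2 : ℝ)) (M := M) hμ hMrev
  have hirr := ptBareSampler_isIrreducible hμ hM hMirr ht0.le ht1
  have h1 := asympVar_le_spectralGap (tensorFun_pos hμ) (sum_tensorFun_eq_one μ hμ1) hP hDB hirr g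
  have hc := ptBareModeHalf_spectralGap_ge hμ hμ1 hmode hK hM hMrev hp hp1 hq0 hq1 hδ0 hδ1 hγ₀ hγA hγA1 hpers hq hδ
    hgap0 hgapA
  have hKr : (1 : ℝ) ≤ K := by exact_mod_cast hK
  have hcpos : 0 < p * q ^ K * γA * min (δ₂ / K ^ 2) (γ₀ / (K + 1)) / (96 * (K + 1) ^ 2) := by
    have : 0 < min (δ₂ / K ^ 2) (γ₀ / (K + 1)) := lt_min (div_pos hδ0 (by positivity)) (div_pos hγ₀ (by positivity))
    positivity
  refine h1.trans (mul_le_mul_of_nonneg_right ?_ (lawVariance_nonneg (fun x => (tensorFun_pos hμ x).le) g))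
  have := div_le_div_of_nonneg_left (by norm_num : (0 : ℝ) ≤ 2) hcpos hc
  linarith

include hμ hμ1 hmode in
/-- **`τ_int(g) ≤ 96(K+1)²/(p q^K γ_A·min{δ₂/K², γ₀/(K+1)}) − ½` for every non-constant observable** of the replica
configurations (`t = ½`; one step = one swap attempt or one replica update): `asympVar(g)/(2Var(g)) ≤ …` — conveyor
length × (ladder diffusion or hot relaxation) × within-mode relaxation over two-sided persistence; the cold replicas'
barrier crossing never enters. [ours] -/
theorem ptBareModeHalf_tauInt_le [Nontrivial S] (hK : 1 ≤ K) (hM : ∀ k, IsRowStochastic (M k))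
    (hMrev : ∀ k, DetailedBalance (μ k) (M k)) (hMirr : ∀ k, IsIrreducible (M k))
    {p q δ₂ γ₀ γA : ℝ} (hp : 0 < p) (hp1 : p ≤ 1) (hq0 : 0 < q) (hq1 : q ≤ 1) (hδ0 : 0 < δ₂) (hδ1 : δ₂ ≤ 1)
    (hγ₀ : 0 < γ₀) (hγA : 0 < γA) (hγA1 : γA ≤ 1)
    (hpers : ∀ (i k : Fin (K + 1)) (j : J), i ≤ k → p * blockMass (μ k) mode j ≤ blockMass (μ i) mode j)
    (hq : ∀ (l : Fin K) (j : J), q * blockMass (μ l.castSucc) mode j ≤ blockMass (μ l.succ) mode j)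
    (hδ : ∀ (m : Fin (K + 1) → J) (l : Fin K), m ∘ levelSwap l ≠ m →
      δ₂ * min (blockMass (tensorFun μ) (fun z : Fin (K + 1) → S => mode ∘ z) m)
          (blockMass (tensorFun μ) (fun z : Fin (K + 1) → S => mode ∘ z) (m ∘ levelSwap l))
        ≤ ∑ x ∈ block (fun z : Fin (K + 1) → S => mode ∘ z) m, min (tensorFun μ x) (tensorFun μ (x ∘ levelSwap l)))
    (hgap0 : ∀ h : J → ℝ, γ₀ * lawVariance (blockMass (μ 0) mode) h
      ≤ dirichletForm (blockMass (μ 0) mode) (projectionChain (μ 0) (M 0) mode) h)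
    (hgapA : ∀ k j, ∀ h : S → ℝ, γA * lawVariance (blockLaw (μ k) mode j) h
      ≤ dirichletForm (blockLaw (μ k) mode j) (restrictionChain (M k) mode) h)
    {g : (Fin (K + 1) → S) → ℝ} (hg : 0 < lawVariance (tensorFun μ) g) :
    asympVar g (tensorFun μ) (ptBareSampler (1 / 2) μ M) / (2 * lawVariance (tensorFun μ) g)
      ≤ 96 * (K + 1) ^ 2 / (p * q ^ K * γA * min (δ₂ / K ^ 2) (γ₀ / (K + 1))) - 1 / 2 := by
  have h := ptBareModeHalf_asympVar_le hμ hμ1 hmode hK hM hMrev hMirr hp hp1 hq0 hq1 hδ0 hδ1 hγ₀ hγA hγA1 hpers hq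
    hδ hgap0 hgapA g
  have hKr : (1 : ℝ) ≤ K := by exact_mod_cast hK
  have hm : 0 < min (δ₂ / K ^ 2) (γ₀ / (K + 1)) := lt_min (div_pos hδ0 (by positivity)) (div_pos hγ₀ (by positivity))
  have hc : 0 < p * q ^ K * γA * min (δ₂ / K ^ 2) (γ₀ / (K + 1)) := by positivity
  rw [div_le_iff₀ (by positivity)]
  have e : (96 * (K + 1) ^ 2 / (p * q ^ K * γA * min (δ₂ / K ^ 2) (γ₀ / (K + 1))) - 1 / 2)
        * (2 * lawVariance (tensorFun μ) g)
      = (2 / (p * q ^ K * γA * min (δ₂ / K ^ 2) (γ₀ / (K + 1)) / (96 * (K + 1) ^ 2)) - 1)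
        * lawVariance (tensorFun μ) g := by
    field_simp
  rw [e]
  exact h

end ModeGap

end Summit.Ventures.LatticeQCDFlow.Scaling
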